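/-
Copyright: rh-split cell (dbn column, prover seat l19-w2) gen 0, 2026-08-27.  LINE 3 «two-ray Laguerre
squeeze» of ideator rh-idea-2 (D-0145): the ABSTRACT real-analysis core of the swing lemma.  Pure calculus
on the real line; nothing here mentions ζ, `H_t` or RH, and nothing here bears on the truth of RH.
-/
import Mathlib.Analysis.Calculus.Deriv.MeanValue
import Mathlib.Analysis.Calculus.Deriv.Inv
import Mathlib.Topology.Order.Monotone
import HarnessLib

/-!
# The swing lemma — abstract core (LINE 3 «two-ray Laguerre squeeze», item `DBN.LinearRaySwingLemma`)

Pure real analysis, no definitions.  DATA: `a > 0`, `x₁ < x₂` with `a (x₂ − x₁) ≤ 1`, and two real functions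
`f, h : ℝ → ℝ`, `f` twice differentiable with the ODE `f'' = a² (f − h)`, `h` differentiable, `h(x₁) = h(x₂) = 0`,
`h ≠ 0` on `(x₁, x₂)`, `h'(x₁) ≠ 0 ≠ h'(x₂)`, and the four ENDPOINT SIGN RULES
`(f + f'/a)(x_i) · h'(x_i) ≥ 0`, `(f − f'/a)(x_i) · h'(x_i) ≤ 0` (`i = 1, 2`).
CONCLUSION (`exists_abs_le_of_swing`): `∃ y ∈ [x₁, x₂], |f(y)| ≤ a (x₂ − x₁) |h(y)|`.

In the application (`Theorems/Splittings/LinearRaySwing.lean`) `f = Re F_a` (the Laplace-smoothed factor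
`deBruijnHDiv (1 + u²/a²)`), `h = Re H_0`, `f ± f'/a = Re linearFactorH (±a)`, and the sign rules are the two
one-point Laguerre certificates of `Theorems/Splittings/LinearRayZeroSigns.lean` GIVEN the linear-factor ray.

PROOF (rh-idea-2's sketch, critic-checked).  If `f` vanishes on `[x₁, x₂]` take `y` there.  Otherwise `f` has
constant sign; the symmetry `(f, h) ↦ (−f, −h)` preserves every hypothesis, so take `f > 0`.  The sign of `h`
on the gap is the sign of `h'(x₁)` and minus the sign of `h'(x₂)` (`exists_pos_right_of_hasDerivAt`,
`pos_of_pos_of_ne_zero`).  With `φ = f'/f`, `φ' = a²(1 − h/f) − φ²`: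
* `h > 0` on the gap: the rules give `φ(x₁) ≥ a`, `φ(x₂) ≤ −a`; a CROSSING sub-interval `[t₁, t₂]`
  (`exists_crossing`: `φ(t₁) ≥ a`, `φ(t₂) ≤ −a`, `|φ| < a` strictly inside; `sSup`/`sInf` of closed sets) and
  the mean value theorem give `y` with `|φ(y)| < a`, `φ'(y) ≤ −2a/(x₂ − x₁)` (`exists_deriv_le_of_swing`), whence
  `a² h(y)/f(y) ≥ 2a/(x₂ − x₁)` and `f(y) ≤ (a(x₂ − x₁)/2) h(y)`;
* `h < 0` on the gap: `φ(x₁) ≤ −a`, `φ(x₂) ≥ a`, `y` with `φ'(y) ≥ 2a/(x₂ − x₁)`, whence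
  `−a² h(y)/f(y) ≥ 2a/(x₂ − x₁) − a² ≥ a/(x₂ − x₁)` (here `a(x₂ − x₁) ≤ 1` is used) and `f(y) ≤ a(x₂ − x₁)(−h(y))`.
No `sorry`, no new axioms, no instances, no notation, no definitions.
-/

set_option linter.dupNamespace false  -- the mandated namespace repeats `RiemannHypothesis`

namespace Summit.RiemannHypothesis.RiemannHypothesis.Theorems.Splittings.LinearRaySwingCore

open Set Filter Topology

/-! ## Constant sign from no zeros (intermediate value theorem) -/

/-- On an order-connected set where a continuous `f` has no zero, one positive value makes `f` positive
everywhere. [folklore] -/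
theorem pos_of_pos_of_ne_zero {f : ℝ → ℝ} {S : Set ℝ} (hS : S.OrdConnected) (hc : ContinuousOn f S)
    (hne : ∀ z ∈ S, f z ≠ 0) {s : ℝ} (hs : s ∈ S) (hpos : 0 < f s) : ∀ z ∈ S, 0 < f z := by
  intro z hz
  by_contra hle
  have hlt : f z < 0 := lt_of_le_of_ne (not_lt.1 hle) (hne z hz)
  have hsub : uIcc s z ⊆ S := hS.uIcc_subset hs hz
  have h0 : (0 : ℝ) ∈ uIcc (f s) (f z) := by
    rw [mem_uIcc]
    exact Or.inr ⟨hlt.le, hpos.le⟩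
  obtain ⟨c, hc', hc0⟩ := intermediate_value_uIcc (hc.mono hsub) h0
  exact hne c (hsub hc') hc0

/-- On an order-connected set where a continuous `f` has no zero, one negative value makes `f` negative
everywhere. [folklore] -/
theorem neg_of_neg_of_ne_zero {f : ℝ → ℝ} {S : Set ℝ} (hS : S.OrdConnected) (hc : ContinuousOn f S)
    (hne : ∀ z ∈ S, f z ≠ 0) {s : ℝ} (hs : s ∈ S) (hneg : f s < 0) : ∀ z ∈ S, f z < 0 := by
  have h := pos_of_pos_of_ne_zero (f := fun x ↦ -f x) hS hc.neg (fun z hz ↦ neg_ne_zero.2 (hne z hz)) hs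
    (neg_pos.2 hneg)
  exact fun z hz ↦ neg_pos.1 (h z hz)

/-! ## The sign of `h` next to a simple zero -/

/-- If `h(x) = 0` and `h'(x) > 0`, then `h > 0` somewhere in every right neighbourhood `(x, b)`. [folklore] -/
theorem exists_pos_right_of_hasDerivAt {h : ℝ → ℝ} {x b d : ℝ} (hd : HasDerivAt h d x) (hx : h x = 0)
    (hpos : 0 < d) (hb : x < b) : ∃ s ∈ Ioo x b, 0 < h s := by
  have ht : Tendsto (slope h x) (𝓝[>] x) (𝓝 d) := (hasDerivAt_iff_tendsto_slope_left_right.1 hd).2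
  have hev : ∀ᶠ s in 𝓝[>] x, 0 < slope h x s := ht.eventually_const_lt hpos
  have hmem : ∀ᶠ s in 𝓝[>] x, s ∈ Ioo x b := Ioo_mem_nhdsGT hb
  obtain ⟨s, hs, hsI⟩ := (hev.and hmem).exists
  refine ⟨s, hsI, ?_⟩
  rw [slope_def_field, hx, sub_zero] at hs
  exact (div_pos_iff_of_pos_right (sub_pos.2 hsI.1)).1 hs

/-- If `h(x) = 0` and `h'(x) > 0`, then `h < 0` somewhere in every left neighbourhood `(b, x)`. [folklore] -/
theorem exists_neg_left_of_hasDerivAt {h : ℝ → ℝ} {x b d : ℝ} (hd : HasDerivAt h d x) (hx : h x = 0)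
    (hpos : 0 < d) (hb : b < x) : ∃ s ∈ Ioo b x, h s < 0 := by
  have ht : Tendsto (slope h x) (𝓝[<] x) (𝓝 d) := (hasDerivAt_iff_tendsto_slope_left_right.1 hd).1
  have hev : ∀ᶠ s in 𝓝[<] x, 0 < slope h x s := ht.eventually_const_lt hpos
  have hmem : ∀ᶠ s in 𝓝[<] x, s ∈ Ioo b x := Ioo_mem_nhdsLT hb
  obtain ⟨s, hs, hsI⟩ := (hev.and hmem).exists
  refine ⟨s, hsI, ?_⟩
  rw [slope_def_field, hx, sub_zero] at hs
  have hsx : s - x < 0 := sub_neg.2 hsI.2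
  have hmul : h s = h s / (s - x) * (s - x) := (div_mul_cancel₀ _ hsx.ne).symm
  rw [hmul]
  exact mul_neg_of_pos_of_neg hs hsx

/-- If `h(x) = 0` and `h'(x) < 0`, then `h < 0` somewhere in every right neighbourhood `(x, b)`. [folklore] -/
theorem exists_neg_right_of_hasDerivAt {h : ℝ → ℝ} {x b d : ℝ} (hd : HasDerivAt h d x) (hx : h x = 0)
    (hneg : d < 0) (hb : x < b) : ∃ s ∈ Ioo x b, h s < 0 := by
  obtain ⟨s, hs, hpos⟩ := exists_pos_right_of_hasDerivAt (h := fun t ↦ -h t) hd.neg (by simp [hx])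
    (neg_pos.2 hneg) hb
  exact ⟨s, hs, neg_pos.1 hpos⟩

/-- If `h(x) = 0` and `h'(x) < 0`, then `h > 0` somewhere in every left neighbourhood `(b, x)`. [folklore] -/
theorem exists_pos_left_of_hasDerivAt {h : ℝ → ℝ} {x b d : ℝ} (hd : HasDerivAt h d x) (hx : h x = 0)
    (hneg : d < 0) (hb : b < x) : ∃ s ∈ Ioo b x, 0 < h s := by
  obtain ⟨s, hs, hlt⟩ := exists_neg_left_of_hasDerivAt (h := fun t ↦ -h t) hd.neg (by simp [hx])
    (neg_pos.2 hneg) hb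
  exact ⟨s, hs, neg_lt_zero.1 hlt⟩

/-! ## Crossing sub-interval and the mean value step -/

/-- **Crossing sub-interval.**  If `φ` is continuous on `[x₁, x₂]` with `φ(x₁) ≥ a` and `φ(x₂) ≤ −a` (`a > 0`),
there are `x₁ ≤ t₁ < t₂ ≤ x₂` with `φ(t₁) ≥ a`, `φ(t₂) ≤ −a` and `|φ| < a` strictly between (`t₁` = the last
point with `φ ≥ a`, `t₂` = the first point after it with `φ ≤ −a`). [folklore] -/
theorem exists_crossing {φ : ℝ → ℝ} {x₁ x₂ a : ℝ} (hx : x₁ < x₂) (hφ : ContinuousOn φ (Icc x₁ x₂))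
    (h₁ : a ≤ φ x₁) (h₂ : φ x₂ ≤ -a) (ha : 0 < a) :
    ∃ t₁ t₂, x₁ ≤ t₁ ∧ t₁ < t₂ ∧ t₂ ≤ x₂ ∧ a ≤ φ t₁ ∧ φ t₂ ≤ -a ∧ ∀ s ∈ Ioo t₁ t₂, |φ s| < a := by
  -- `t₁` = the last point of `[x₁, x₂]` with `φ ≥ a`
  let S : Set ℝ := Icc x₁ x₂ ∩ φ ⁻¹' (Ici a)
  have hSc : IsClosed S := hφ.preimage_isClosed_of_isClosed isClosed_Icc isClosed_Ici
  have hSne : S.Nonempty := ⟨x₁, ⟨left_mem_Icc.2 hx.le, h₁⟩⟩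
  have hSbdd : BddAbove S := ⟨x₂, fun s hs ↦ hs.1.2⟩
  have ht₁S : sSup S ∈ S := hSc.csSup_mem hSne hSbdd
  have ht₁x : sSup S ∈ Icc x₁ x₂ := ht₁S.1
  have hφt₁ : a ≤ φ (sSup S) := ht₁S.2
  have habove : ∀ s ∈ Icc x₁ x₂, sSup S < s → φ s < a := fun s hs hts ↦ by
    by_contra hcon
    exact absurd (le_csSup hSbdd ⟨hs, not_lt.1 hcon⟩) (not_le.2 hts)
  have ht₁lt : sSup S < x₂ := lt_of_le_of_ne ht₁x.2 fun heq ↦ by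
    rw [heq] at hφt₁
    linarith
  -- `t₂` = the first point of `[t₁, x₂]` with `φ ≤ -a`
  let T : Set ℝ := Icc (sSup S) x₂ ∩ φ ⁻¹' (Iic (-a))
  have hTc : IsClosed T :=
    (hφ.mono (Icc_subset_Icc_left ht₁x.1)).preimage_isClosed_of_isClosed isClosed_Icc isClosed_Iic
  have hTne : T.Nonempty := ⟨x₂, ⟨right_mem_Icc.2 ht₁lt.le, h₂⟩⟩
  have hTbdd : BddBelow T := ⟨sSup S, fun s hs ↦ hs.1.1⟩
  have ht₂T : sInf T ∈ T := hTc.csInf_mem hTne hTbdd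
  have ht₂x : sInf T ∈ Icc (sSup S) x₂ := ht₂T.1
  have hφt₂ : φ (sInf T) ≤ -a := ht₂T.2
  have hbelow : ∀ s ∈ Icc (sSup S) x₂, s < sInf T → -a < φ s := fun s hs hst ↦ by
    by_contra hcon
    exact absurd (csInf_le hTbdd ⟨hs, not_lt.1 hcon⟩) (not_le.2 hst)
  have ht₁t₂ : sSup S < sInf T := lt_of_le_of_ne ht₂x.1 fun heq ↦ by
    rw [← heq] at hφt₂
    linarith
  refine ⟨sSup S, sInf T, ht₁x.1, ht₁t₂, ht₂x.2, hφt₁, hφt₂, fun s hs ↦ abs_lt.2 ⟨?_, ?_⟩⟩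
  · exact hbelow s ⟨hs.1.le, hs.2.le.trans ht₂x.2⟩ hs.2
  · exact habove s ⟨ht₁x.1.trans hs.1.le, hs.2.le.trans ht₂x.2⟩ hs.1

/-- **Downward swing.**  If `φ` is continuous on `[x₁, x₂]`, differentiable inside, `φ(x₁) ≥ a` and
`φ(x₂) ≤ −a` (`a > 0`), then at some interior point `|φ| < a` and `φ' ≤ −2a/(x₂ − x₁)` (mean value theorem on
a crossing sub-interval). [folklore] -/
theorem exists_deriv_le_of_swing {φ φ' : ℝ → ℝ} {x₁ x₂ a : ℝ} (hx : x₁ < x₂)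
    (hφ : ContinuousOn φ (Icc x₁ x₂)) (hφ' : ∀ x ∈ Ioo x₁ x₂, HasDerivAt φ (φ' x) x)
    (h₁ : a ≤ φ x₁) (h₂ : φ x₂ ≤ -a) (ha : 0 < a) :
    ∃ y ∈ Ioo x₁ x₂, |φ y| < a ∧ φ' y ≤ -(2 * a) / (x₂ - x₁) := by
  obtain ⟨t₁, t₂, ht₁, ht₁₂, ht₂, hφ₁, hφ₂, hin⟩ := exists_crossing hx hφ h₁ h₂ ha
  have hsub : Icc t₁ t₂ ⊆ Icc x₁ x₂ := Icc_subset_Icc ht₁ ht₂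
  have hsub' : Ioo t₁ t₂ ⊆ Ioo x₁ x₂ := Ioo_subset_Ioo ht₁ ht₂
  obtain ⟨y, hy, hslope⟩ :=
    exists_hasDerivAt_eq_slope φ φ' ht₁₂ (hφ.mono hsub) (fun x hx' ↦ hφ' x (hsub' hx'))
  refine ⟨y, hsub' hy, hin y hy, ?_⟩
  have hδ : 0 < t₂ - t₁ := sub_pos.2 ht₁₂
  have hΔ : 0 < x₂ - x₁ := sub_pos.2 hx
  rw [hslope, div_le_iff₀ hδ, div_mul_eq_mul_div, le_div_iff₀ hΔ]
  have hφ₁₂ : φ t₂ - φ t₁ ≤ -(2 * a) := by linarith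
  have hle : t₂ - t₁ ≤ x₂ - x₁ := by linarith
  nlinarith [mul_le_mul_of_nonpos_left hle (by linarith : φ t₂ - φ t₁ ≤ 0)]

/-- **Upward swing** (the mirror image of `exists_deriv_le_of_swing`): `φ(x₁) ≤ −a`, `φ(x₂) ≥ a` give an
interior point with `|φ| < a` and `φ' ≥ 2a/(x₂ − x₁)`. [folklore] -/
theorem exists_deriv_ge_of_swing {φ φ' : ℝ → ℝ} {x₁ x₂ a : ℝ} (hx : x₁ < x₂)
    (hφ : ContinuousOn φ (Icc x₁ x₂)) (hφ' : ∀ x ∈ Ioo x₁ x₂, HasDerivAt φ (φ' x) x)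
    (h₁ : φ x₁ ≤ -a) (h₂ : a ≤ φ x₂) (ha : 0 < a) :
    ∃ y ∈ Ioo x₁ x₂, |φ y| < a ∧ 2 * a / (x₂ - x₁) ≤ φ' y := by
  obtain ⟨y, hy, habs, hle⟩ := exists_deriv_le_of_swing (φ := fun x ↦ -φ x) (φ' := fun x ↦ -φ' x) hx
    hφ.neg (fun x hx' ↦ (hφ' x hx').neg) (by linarith) (by linarith) ha
  refine ⟨y, hy, by simpa [abs_neg] using habs, ?_⟩
  simp only [neg_div, neg_le_neg_iff] at hle
  exact hle

/-! ## The swing lemma for a positive `f` -/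

/-- **Abstract swing lemma, `f > 0` on `[x₁, x₂]`.**  See the module docstring for the statement and proof;
the two cases are the sign of `h` on the gap. -/
theorem exists_abs_le_of_swing_of_pos {f f' h h' : ℝ → ℝ} {a x₁ x₂ : ℝ} (ha : 0 < a) (hx : x₁ < x₂)
    (haδ : a * (x₂ - x₁) ≤ 1)
    (hf : ∀ x, HasDerivAt f (f' x) x) (hf' : ∀ x, HasDerivAt f' (a ^ 2 * (f x - h x)) x)
    (hh : ∀ x, HasDerivAt h (h' x) x)
    (hz₁ : h x₁ = 0) (hz₂ : h x₂ = 0) (hne : ∀ z ∈ Ioo x₁ x₂, h z ≠ 0) (hd₁ : h' x₁ ≠ 0) (hd₂ : h' x₂ ≠ 0)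
    (r₁p : 0 ≤ (f x₁ + f' x₁ / a) * h' x₁) (r₁m : (f x₁ - f' x₁ / a) * h' x₁ ≤ 0)
    (r₂p : 0 ≤ (f x₂ + f' x₂ / a) * h' x₂) (r₂m : (f x₂ - f' x₂ / a) * h' x₂ ≤ 0)
    (hfpos : ∀ x ∈ Icc x₁ x₂, 0 < f x) :
    ∃ y ∈ Icc x₁ x₂, |f y| ≤ a * (x₂ - x₁) * |h y| := by
  have ha0 : a ≠ 0 := ha.ne'
  have hΔ : 0 < x₂ - x₁ := sub_pos.2 hx
  have hf₁ : 0 < f x₁ := hfpos x₁ (left_mem_Icc.2 hx.le)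
  have hf₂ : 0 < f x₂ := hfpos x₂ (right_mem_Icc.2 hx.le)
  -- the logarithmic derivative `φ = f'/f` and its derivative on `[x₁, x₂]`
  have hφd : ∀ x ∈ Icc x₁ x₂, HasDerivAt (fun t ↦ f' t / f t)
      ((a ^ 2 * (f x - h x) * f x - f' x * f' x) / f x ^ 2) x :=
    fun x hxI ↦ (hf' x).div (hf x) (hfpos x hxI).ne'
  have hφc : ContinuousOn (fun t ↦ f' t / f t) (Icc x₁ x₂) :=
    fun x hxI ↦ (hφd x hxI).continuousAt.continuousWithinAt
  have hφd' : ∀ x ∈ Ioo x₁ x₂, HasDerivAt (fun t ↦ f' t / f t)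
      ((a ^ 2 * (f x - h x) * f x - f' x * f' x) / f x ^ 2) x :=
    fun x hxI ↦ hφd x (Ioo_subset_Icc_self hxI)
  -- `h` is continuous; its sign on the gap is decided at `x₁`
  have hhc : ContinuousOn h (Ioo x₁ x₂) := fun x _ ↦ (hh x).continuousAt.continuousWithinAt
  rcases lt_or_gt_of_ne hd₁ with hd₁neg | hd₁pos
  · -- `h'(x₁) < 0`: `h < 0` on the gap, `h'(x₂) > 0`; upward swing
    obtain ⟨s, hs, hs0⟩ := exists_neg_right_of_hasDerivAt (hh x₁) hz₁ hd₁neg hx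
    have hneg : ∀ z ∈ Ioo x₁ x₂, h z < 0 := neg_of_neg_of_ne_zero ordConnected_Ioo hhc hne hs hs0
    have hd₂pos : 0 < h' x₂ := by
      rcases lt_or_gt_of_ne hd₂ with hlt | hgt
      · obtain ⟨s', hs', hs'0⟩ := exists_pos_left_of_hasDerivAt (hh x₂) hz₂ hlt hx
        exact absurd hs'0 (not_lt.2 (hneg s' hs').le)
      · exact hgt
    -- endpoint slopes: `φ(x₁) ≤ -a`, `φ(x₂) ≥ a`
    have e₁ : f x₁ + f' x₁ / a ≤ 0 := by nlinarith [r₁p, hd₁neg]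
    have hφ₁ : f' x₁ / f x₁ ≤ -a := by
      rw [div_le_iff₀ hf₁]
      have e : a * (f x₁ + f' x₁ / a) = a * f x₁ + f' x₁ := by rw [mul_add, mul_div_cancel₀ _ ha0]
      nlinarith [mul_nonpos_of_nonneg_of_nonpos ha.le e₁, e]
    have e₂ : f x₂ - f' x₂ / a ≤ 0 := by nlinarith [r₂m, hd₂pos]
    have hφ₂ : a ≤ f' x₂ / f x₂ := by
      rw [le_div_iff₀ hf₂]
      have e : a * (f x₂ - f' x₂ / a) = a * f x₂ - f' x₂ := by rw [mul_sub, mul_div_cancel₀ _ ha0]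
      nlinarith [mul_nonpos_of_nonneg_of_nonpos ha.le e₂, e]
    obtain ⟨y, hy, -, hge⟩ := exists_deriv_ge_of_swing hx hφc hφd' hφ₁ hφ₂ ha
    have hyI : y ∈ Icc x₁ x₂ := Ioo_subset_Icc_self hy
    have hfy : 0 < f y := hfpos y hyI
    have hhy : h y < 0 := hneg y hy
    refine ⟨y, hyI, ?_⟩
    rw [abs_of_pos hfy, abs_of_neg hhy]
    -- clear denominators in `hge : 2a/(x₂-x₁) ≤ φ'(y)`
    rw [div_le_iff₀ hΔ, div_mul_eq_mul_div, le_div_iff₀ (pow_pos hfy 2)] at hge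
    have haf : 0 < a * f y := mul_pos ha hfy
    have p1 : 0 ≤ (x₂ - x₁) * (f' y * f' y) := mul_nonneg hΔ.le (mul_self_nonneg _)
    have p2 : a * (x₂ - x₁) * (a * f y * f y) ≤ 1 * (a * f y * f y) :=
      mul_le_mul_of_nonneg_right haδ (mul_pos haf hfy).le
    by_contra hcon
    have p3 : a * f y * (a * (x₂ - x₁) * -h y) < a * f y * f y :=
      mul_lt_mul_of_pos_left (not_le.1 hcon) haf
    nlinarith [hge, p1, p2, p3]
  · -- `h'(x₁) > 0`: `h > 0` on the gap, `h'(x₂) < 0`; downward swing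
    obtain ⟨s, hs, hs0⟩ := exists_pos_right_of_hasDerivAt (hh x₁) hz₁ hd₁pos hx
    have hpos : ∀ z ∈ Ioo x₁ x₂, 0 < h z := pos_of_pos_of_ne_zero ordConnected_Ioo hhc hne hs hs0
    have hd₂neg : h' x₂ < 0 := by
      rcases lt_or_gt_of_ne hd₂ with hlt | hgt
      · exact hlt
      · obtain ⟨s', hs', hs'0⟩ := exists_neg_left_of_hasDerivAt (hh x₂) hz₂ hgt hx
        exact absurd hs'0 (not_lt.2 (hpos s' hs').le)
    -- endpoint slopes: `φ(x₁) ≥ a`, `φ(x₂) ≤ -a`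
    have e₁ : f x₁ - f' x₁ / a ≤ 0 := by nlinarith [r₁m, hd₁pos]
    have hφ₁ : a ≤ f' x₁ / f x₁ := by
      rw [le_div_iff₀ hf₁]
      have e : a * (f x₁ - f' x₁ / a) = a * f x₁ - f' x₁ := by rw [mul_sub, mul_div_cancel₀ _ ha0]
      nlinarith [mul_nonpos_of_nonneg_of_nonpos ha.le e₁, e]
    have e₂ : f x₂ + f' x₂ / a ≤ 0 := by nlinarith [r₂p, hd₂neg]
    have hφ₂ : f' x₂ / f x₂ ≤ -a := by
      rw [div_le_iff₀ hf₂]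
      have e : a * (f x₂ + f' x₂ / a) = a * f x₂ + f' x₂ := by rw [mul_add, mul_div_cancel₀ _ ha0]
      nlinarith [mul_nonpos_of_nonneg_of_nonpos ha.le e₂, e]
    obtain ⟨y, hy, habs, hle⟩ := exists_deriv_le_of_swing hx hφc hφd' hφ₁ hφ₂ ha
    have hyI : y ∈ Icc x₁ x₂ := Ioo_subset_Icc_self hy
    have hfy : 0 < f y := hfpos y hyI
    have hhy : 0 < h y := hpos y hy
    refine ⟨y, hyI, ?_⟩
    rw [abs_of_pos hfy, abs_of_pos hhy]
    -- clear denominators in `hle : φ'(y) ≤ -2a/(x₂-x₁)` and in `|φ(y)| < a`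
    rw [div_le_iff₀ (pow_pos hfy 2), div_mul_eq_mul_div, le_div_iff₀ hΔ] at hle
    rw [abs_div, abs_of_pos hfy, div_lt_iff₀ hfy] at habs
    obtain ⟨hP₁, hP₂⟩ := abs_lt.1 habs
    have haf : 0 < a * f y := mul_pos ha hfy
    have hP : f' y * f' y < a * f y * (a * f y) := by nlinarith [hP₁, hP₂]
    have p1 : (x₂ - x₁) * (f' y * f' y) < (x₂ - x₁) * (a * f y * (a * f y)) :=
      mul_lt_mul_of_pos_left hP hΔ
    by_contra hcon
    have p3 : a * f y * (a * (x₂ - x₁) * h y) < a * f y * f y :=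
      mul_lt_mul_of_pos_left (not_le.1 hcon) haf
    nlinarith [hle, p1, p3, mul_pos (mul_pos haf hhy) hΔ]

/-! ## The swing lemma -/

/-- **Abstract swing lemma.**  `a > 0`, `x₁ < x₂`, `a (x₂ − x₁) ≤ 1`; `f'' = a² (f − h)`, `h' = h'`;
`h(x₁) = h(x₂) = 0`, `h ≠ 0` on `(x₁, x₂)`, `h'(x₁) ≠ 0 ≠ h'(x₂)`; endpoint sign rules
`(f + f'/a)(x_i) h'(x_i) ≥ 0`, `(f − f'/a)(x_i) h'(x_i) ≤ 0`.  Then `|f(y)| ≤ a (x₂ − x₁) |h(y)|` for some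
`y ∈ [x₁, x₂]`.  (If `f` vanishes on the interval take that point; else `f` has constant sign and the
symmetry `(f, h) ↦ (−f, −h)` reduces to `exists_abs_le_of_swing_of_pos`.) -/
theorem exists_abs_le_of_swing {f f' h h' : ℝ → ℝ} {a x₁ x₂ : ℝ} (ha : 0 < a) (hx : x₁ < x₂)
    (haδ : a * (x₂ - x₁) ≤ 1)
    (hf : ∀ x, HasDerivAt f (f' x) x) (hf' : ∀ x, HasDerivAt f' (a ^ 2 * (f x - h x)) x)
    (hh : ∀ x, HasDerivAt h (h' x) x)
    (hz₁ : h x₁ = 0) (hz₂ : h x₂ = 0) (hne : ∀ z ∈ Ioo x₁ x₂, h z ≠ 0) (hd₁ : h' x₁ ≠ 0) (hd₂ : h' x₂ ≠ 0)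
    (r₁p : 0 ≤ (f x₁ + f' x₁ / a) * h' x₁) (r₁m : (f x₁ - f' x₁ / a) * h' x₁ ≤ 0)
    (r₂p : 0 ≤ (f x₂ + f' x₂ / a) * h' x₂) (r₂m : (f x₂ - f' x₂ / a) * h' x₂ ≤ 0) :
    ∃ y ∈ Icc x₁ x₂, |f y| ≤ a * (x₂ - x₁) * |h y| := by
  by_cases hzero : ∃ y ∈ Icc x₁ x₂, f y = 0
  · obtain ⟨y, hy, hfy⟩ := hzero
    refine ⟨y, hy, ?_⟩
    rw [hfy, abs_zero]
    exact mul_nonneg (mul_nonneg ha.le (sub_pos.2 hx).le) (abs_nonneg _)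
  push Not at hzero
  have hfc : ContinuousOn f (Icc x₁ x₂) := fun x _ ↦ (hf x).continuousAt.continuousWithinAt
  have hx₁I : x₁ ∈ Icc x₁ x₂ := left_mem_Icc.2 hx.le
  rcases lt_or_gt_of_ne (hzero x₁ hx₁I) with hneg | hpos
  · -- `f < 0` on `[x₁, x₂]`: apply the positive case to `(-f, -h)`
    have hfneg : ∀ x ∈ Icc x₁ x₂, f x < 0 := neg_of_neg_of_ne_zero ordConnected_Icc hfc hzero hx₁I hneg
    obtain ⟨y, hy, hb⟩ := exists_abs_le_of_swing_of_pos (f := fun x ↦ -f x) (f' := fun x ↦ -f' x)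
      (h := fun x ↦ -h x) (h' := fun x ↦ -h' x) ha hx haδ (fun x ↦ (hf x).neg)
      (fun x ↦ ((hf' x).neg).congr_deriv (by ring)) (fun x ↦ (hh x).neg)
      (by simp [hz₁]) (by simp [hz₂]) (fun z hz ↦ neg_ne_zero.2 (hne z hz))
      (neg_ne_zero.2 hd₁) (neg_ne_zero.2 hd₂)
      (by have e : (-f x₁ + -f' x₁ / a) * -h' x₁ = (f x₁ + f' x₁ / a) * h' x₁ := by ring
          rw [e]; exact r₁p)
      (by have e : (-f x₁ - -f' x₁ / a) * -h' x₁ = (f x₁ - f' x₁ / a) * h' x₁ := by ring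
          rw [e]; exact r₁m)
      (by have e : (-f x₂ + -f' x₂ / a) * -h' x₂ = (f x₂ + f' x₂ / a) * h' x₂ := by ring
          rw [e]; exact r₂p)
      (by have e : (-f x₂ - -f' x₂ / a) * -h' x₂ = (f x₂ - f' x₂ / a) * h' x₂ := by ring
          rw [e]; exact r₂m)
      (fun x hxI ↦ neg_pos.2 (hfneg x hxI))
    exact ⟨y, hy, by simpa [abs_neg] using hb⟩
  · -- `f > 0` on `[x₁, x₂]`
    have hfpos : ∀ x ∈ Icc x₁ x₂, 0 < f x := pos_of_pos_of_ne_zero ordConnected_Icc hfc hzero hx₁I hpos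
    exact exists_abs_le_of_swing_of_pos ha hx haδ hf hf' hh hz₁ hz₂ hne hd₁ hd₂ r₁p r₁m r₂p r₂m hfpos

end Summit.RiemannHypothesis.RiemannHypothesis.Theorems.Splittings.LinearRaySwingCore
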